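import Mathlib.LinearAlgebra.Matrix.Hermitian
import Mathlib.LinearAlgebra.Matrix.NonsingularInverse

/-!
# Over `F × F` with the swap involution every invertible hermitian matrix is congruent to `1`
(cell pub-hodge-repro2, seat p3)

Tier-5 N2 support, row N2.2.2 of route/T5-N2-route-3.md, the SPLIT case: «split v: N2.2.2 does not apply,
W_{A,v} ≅ W_{B,v} automatically — Shimura §1.8 (S-7): one class per dimension in the split case, Gross «unique
Hermitian space of each dimension»» (N2.7.2). At a split place the local «field» `E_v = F_v × F_v` carries the
SWAP involution (files 127 / 130: `E_v ≅ K_w × K_{w'}` with `c` exchanging the factors, `K_w = K⁺_v = K_{w'}`), and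
a hermitian form over it is a pair `(A, Aᵀ)`; `P = (A⁻¹, 1)` is a congruence to the identity. This file proves that
abstractly: for any field `F`, with `swapStarRing : StarRing (F × F)` (a definition, never an instance — `Prod` has
Mathlib's componentwise star), **`exists_conjTranspose_mul_eq_one`**: every hermitian `H` with `IsUnit H.det` has
`P` with `IsUnit P.det` and `Pᴴ * H * P = 1` — ONE isometry class of non-degenerate hermitian spaces in each
dimension. Mathlib only. No display; no device. §8(d): uses an L-value-free non-vanishing device: NO.
-/

namespace Summit.Ventures.HodgeRepro2.T5SplitHermitianClass

open Matrix

section SwapStar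

variable (F : Type*) [CommRing F]

/-- **The swap involution** on `F × F`, `(a, b) ↦ (b, a)`, as a star-ring structure (a definition, not an
instance). -/
abbrev swapStarRing : StarRing (F × F) where
  star p := (p.2, p.1)
  star_involutive _ := rfl
  star_mul p q := by ext <;> simp [mul_comm]
  star_add _ _ := rfl

/-- `star (a, b) = (b, a)`. -/
theorem swap_star_apply (p : F × F) :
    letI := swapStarRing F
    star p = (p.2, p.1) := rfl

end SwapStar

section Matrices

variable {F : Type*} [CommRing F] {n : Type*} [Fintype n] [DecidableEq n]

omit [CommRing F] [Fintype n] [DecidableEq n] in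
/-- Two matrices over `F × F` agree if both projections agree. -/
theorem ext_of_map_fst_snd {M N : Matrix n n (F × F)} (h1 : M.map Prod.fst = N.map Prod.fst)
    (h2 : M.map Prod.snd = N.map Prod.snd) : M = N := by
  ext i j
  · exact congrFun (congrFun h1 i) j
  · exact congrFun (congrFun h2 i) j

omit [Fintype n] [DecidableEq n] in
/-- The first projection of the conjugate transpose (swap star) is the transpose of the second projection. -/
theorem conjTranspose_map_fst (H : Matrix n n (F × F)) :
    letI := swapStarRing F
    Hᴴ.map Prod.fst = (H.map Prod.snd)ᵀ := by
  ext i j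
  rfl

omit [Fintype n] [DecidableEq n] in
/-- The second projection of the conjugate transpose (swap star) is the transpose of the first projection. -/
theorem conjTranspose_map_snd (H : Matrix n n (F × F)) :
    letI := swapStarRing F
    Hᴴ.map Prod.snd = (H.map Prod.fst)ᵀ := by
  ext i j
  rfl

omit [Fintype n] [DecidableEq n] in
/-- **A hermitian matrix over `(F × F, swap)` is a pair `(A, Aᵀ)`.** -/
theorem map_snd_eq_transpose_of_isHermitian (H : Matrix n n (F × F))
    (hH : letI := swapStarRing F; H.IsHermitian) :
    H.map Prod.snd = (H.map Prod.fst)ᵀ := by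
  letI := swapStarRing F
  have h : Hᴴ = H := hH
  conv_lhs => rw [← h]
  exact conjTranspose_map_snd H

/-- The determinant over `F × F` is the pair of the determinants of the projections. -/
theorem det_eq_pair (M : Matrix n n (F × F)) : M.det = ((M.map Prod.fst).det, (M.map Prod.snd).det) := by
  ext
  · show (RingHom.fst F F) M.det = (M.map Prod.fst).det
    rw [RingHom.map_det, RingHom.mapMatrix_apply]
    rfl
  · show (RingHom.snd F F) M.det = (M.map Prod.snd).det
    rw [RingHom.map_det, RingHom.mapMatrix_apply]
    rfl

/-- `IsUnit M.det` over `F × F` means both projections have unit determinant. -/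
theorem isUnit_det_iff (M : Matrix n n (F × F)) :
    IsUnit M.det ↔ IsUnit (M.map Prod.fst).det ∧ IsUnit (M.map Prod.snd).det := by
  rw [det_eq_pair, Prod.isUnit_iff]

/-- The matrix `(A, B)` with the given projections. -/
def pairMatrix (A B : Matrix n n F) : Matrix n n (F × F) := Matrix.of fun i j => (A i j, B i j)

omit [CommRing F] [Fintype n] [DecidableEq n] in
/-- The first projection of `pairMatrix A B` is `A`. -/
@[simp] theorem pairMatrix_map_fst (A B : Matrix n n F) : (pairMatrix A B).map Prod.fst = A := by
  ext i j; rfl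

omit [CommRing F] [Fintype n] [DecidableEq n] in
/-- The second projection of `pairMatrix A B` is `B`. -/
@[simp] theorem pairMatrix_map_snd (A B : Matrix n n F) : (pairMatrix A B).map Prod.snd = B := by
  ext i j; rfl

omit [DecidableEq n] in
/-- Multiplication over `F × F` is componentwise (first projection). -/
theorem map_fst_mul (M N : Matrix n n (F × F)) : (M * N).map Prod.fst = M.map Prod.fst * N.map Prod.fst :=
  Matrix.map_mul (f := RingHom.fst F F)

omit [DecidableEq n] in
/-- Multiplication over `F × F` is componentwise (second projection). -/
theorem map_snd_mul (M N : Matrix n n (F × F)) : (M * N).map Prod.snd = M.map Prod.snd * N.map Prod.snd :=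
  Matrix.map_mul (f := RingHom.snd F F)

/-- **ONE CLASS PER DIMENSION at a split place:** every hermitian matrix over `(F × F, swap)` with unit determinant
is congruent to the identity, by `P = (A⁻¹, 1)` where `H = (A, Aᵀ)`. -/
theorem exists_conjTranspose_mul_eq_one (H : Matrix n n (F × F))
    (hH : letI := swapStarRing F; H.IsHermitian) (hdet : IsUnit H.det) :
    letI := swapStarRing F
    ∃ P : Matrix n n (F × F), IsUnit P.det ∧ Pᴴ * H * P = 1 := by
  letI := swapStarRing F
  set A := H.map Prod.fst with hA
  have hB : H.map Prod.snd = Aᵀ := map_snd_eq_transpose_of_isHermitian H hH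
  have hAdet : IsUnit A.det := ((isUnit_det_iff H).mp hdet).1
  refine ⟨pairMatrix A⁻¹ 1, ?_, ?_⟩
  · rw [isUnit_det_iff, pairMatrix_map_fst, pairMatrix_map_snd, det_one]
    exact ⟨Matrix.isUnit_nonsing_inv_det A hAdet, isUnit_one⟩
  · refine ext_of_map_fst_snd ?_ ?_
    · rw [map_fst_mul, map_fst_mul, conjTranspose_map_fst, pairMatrix_map_snd, pairMatrix_map_fst, transpose_one,
        one_mul, Matrix.mul_nonsing_inv A hAdet, Matrix.map_one _ rfl rfl]
    · rw [map_snd_mul, map_snd_mul, conjTranspose_map_snd, pairMatrix_map_fst, pairMatrix_map_snd, hB, mul_one,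
        ← transpose_mul, Matrix.mul_nonsing_inv A hAdet, transpose_one, Matrix.map_one _ rfl rfl]

/-- **Any two hermitian matrices with unit determinant are congruent** over `(F × F, swap)`. -/
theorem exists_conjTranspose_mul_eq (H₁ H₂ : Matrix n n (F × F))
    (h₁ : letI := swapStarRing F; H₁.IsHermitian) (h₂ : letI := swapStarRing F; H₂.IsHermitian)
    (d₁ : IsUnit H₁.det) (d₂ : IsUnit H₂.det) :
    letI := swapStarRing F
    ∃ P : Matrix n n (F × F), IsUnit P.det ∧ Pᴴ * H₁ * P = H₂ := by
  letI := swapStarRing F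
  obtain ⟨P₁, hP₁, e₁⟩ := exists_conjTranspose_mul_eq_one H₁ h₁ d₁
  obtain ⟨P₂, hP₂, e₂⟩ := exists_conjTranspose_mul_eq_one H₂ h₂ d₂
  -- `P := P₁ * P₂⁻¹`: `(P₁ P₂⁻¹)ᴴ H₁ (P₁ P₂⁻¹) = (P₂⁻¹)ᴴ (P₁ᴴ H₁ P₁) P₂⁻¹ = (P₂⁻¹)ᴴ P₂⁻¹ = H₂`
  have hP₂' : IsUnit P₂⁻¹.det := Matrix.isUnit_nonsing_inv_det P₂ hP₂
  refine ⟨P₁ * P₂⁻¹, ?_, ?_⟩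
  · rw [det_mul]
    exact hP₁.mul hP₂'
  · have key : (P₂⁻¹)ᴴ * P₂⁻¹ = H₂ := by
      calc (P₂⁻¹)ᴴ * P₂⁻¹ = (P₂⁻¹)ᴴ * (P₂ᴴ * H₂ * P₂) * P₂⁻¹ := by rw [e₂, Matrix.mul_one]
        _ = (P₂ * P₂⁻¹)ᴴ * H₂ * (P₂ * P₂⁻¹) := by
          rw [conjTranspose_mul]
          simp only [Matrix.mul_assoc]
        _ = H₂ := by rw [Matrix.mul_nonsing_inv P₂ hP₂, conjTranspose_one, Matrix.one_mul, Matrix.mul_one]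
    calc (P₁ * P₂⁻¹)ᴴ * H₁ * (P₁ * P₂⁻¹) = (P₂⁻¹)ᴴ * (P₁ᴴ * H₁ * P₁) * P₂⁻¹ := by
          rw [conjTranspose_mul]
          simp only [Matrix.mul_assoc]
      _ = H₂ := by rw [e₁, Matrix.mul_one, key]

end Matrices

end Summit.Ventures.HodgeRepro2.T5SplitHermitianClass
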